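import Literature.IUT.LogThetaLattice.GlobalKummerNonInterference
import HarnessLib

/-!
# [IUTchIII] Remark 3.10.1 (i)/(ii) — what the typed MOD/𝔪𝔬𝔡 CONTRAST amounts to at the abstract level:
# log-link-compatible Kummer families exist iff every log-link map is a bijection (proof-only companion)

S. Mochizuki, *Inter-universal Teichmüller theory III*, kurims manuscript (May 2020), Remark 3.10.1 (i),
pp. 149–150 [claim: Mochizuki2012, status: disputed]: "one cannot construct log-link-compatible
isomorphisms of Frobenioids for '`(†𝓕⊛_𝔪𝔬𝔡)_α`' as in the first display of Proposition 3.10, (iii)" [because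
the local monoids are subject to "'upper semi-compatibility', i.e., in a word, one-sided inclusions, as
opposed to precise equalities"]; (ii), p. 150: "the mutual compatibility of the isomorphisms
`^{n,m}𝔉^{⊩⊥}_LGP ⥲ 𝔉^{⊩⊥}(^{n,∘}𝓗𝓣^{𝒟-Θ^{±ell}NF})_LGP` … asserts, in effect, that such Kummer-detachment
indeterminacies do not arise."

The statement file `GlobalKummerNonInterference.lean` (abc-iut-L6-t4, v4 = p407875) types, over ABSTRACT
data (a `ℤ`-indexed family of Frobenius-like objects `F m`, log-link maps `lg m : F m → F (m+1)`, a coric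
object `C`): `Prop310iii_compatible F kum lg` ("`kum (m+1) ∘ lg m = kum m`"), `Remark3101i_noCompatibleIso F
lg` ("no compatible family `kum : ∀ m, F m ≃ C` exists") and the v4 "contentful reading"
`Remark3101ii_contrast` = (a compatible family EXISTS on the `MOD`/LGP side) ∧ (`Remark3101i_noCompatibleIso`
on the `𝔪𝔬𝔡`/lgp side); it proves `lg_bijective_of_compatible` (compatibility forces each `lg m` to be a
bijection).

THIS FILE (proof-only; RQ7-style second-pass product of abc-iut-L6-d3 on p407875, advisory A1) PROVES the
converse and hence the exact abstract content of these predicates: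

* `exists_compatible_of_bijective` — if every log-link map `lg m` is a bijection and `F 0 ≃ C`, then a
  log-link-compatible Kummer family EXISTS (built by two-sided recursion along the column,
  `Int.inductionOn'`);
* **`exists_compatible_iff`** — `(∃ kum, Prop310iii_compatible F kum lg) ↔ (∀ m, Bijective (lg m)) ∧
  Nonempty (F 0 ≃ C)`;
* **`Remark3101i_noCompatibleIso_iff`** — the typed `𝔪𝔬𝔡`-side obstruction holds iff SOME log-link map is not
  a bijection OR `F 0` and `C` are not in bijection; in particular `Remark3101i_noCompatibleIso_of_not_bijective`
  (the intended mechanism: "one-sided inclusions, as opposed to precise equalities" ⇒ a non-bijective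
  log-link map) and `Remark3101i_noCompatibleIso_of_isEmpty` (the JUNK escape: with a coric object of the
  wrong cardinality the obstruction holds for every `lg`);
* **`Remark3101ii_contrast_iff`** — the v4 contrast is EQUIVALENT to: all `MOD`-side log-link maps are
  bijections and `FMOD 0 ≃ CMOD` is inhabited, while on the `𝔪𝔬𝔡` side some log-link map is not a bijection
  or `Ffrak 0 ≃ Cfrak` is empty.

READING (neutral): at the abstract level of the statement file, the MOD/𝔪𝔬𝔡 contrast of Rmk. 3.10.1 (i)(ii)
is exactly a statement about (non-)bijectivity of the abstract log-link maps plus a cardinality side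
condition on the chosen coric objects; any consumer (e.g. the Cor. 3.12 proof-step index, which PINS
Rmk. 3.10.1 (ii) at Steps (ix)/(x)) should instantiate `Cfrak` by the genuine coric object (so that
`Ffrak 0 ≃ Cfrak` is inhabited) lest the second conjunct hold for the junk reason. Nothing here asserts
anything about [IUTchIII] Cor. 3.12 or takes a side; typed ≠ discharged. [claim: Mochizuki2012, status:
disputed] for the quoted sentences; the mathematics is elementary (transport of bijections along `ℤ`).
-/

namespace Literature.IUT.LogThetaLattice

universe u

section CompatibleFamilies

variable {C : Type u} {F : ℤ → Type u} {lg : ∀ m, F m → F (m + 1)}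

/-- Transport of a Kummer family along an equality of indices. [claim: Mochizuki2012, status: disputed] -/
private theorem kum_cast_apply (kum : ∀ m, F m ≃ C) {a b : ℤ} (h : a = b) (x : F a) :
    kum b (cast (congrArg F h) x) = kum a x := by
  subst h
  rfl

/-- Transport of the log-link maps along an equality of indices. [claim: Mochizuki2012, status: disputed] -/
private theorem lg_cast_apply (lg : ∀ m, F m → F (m + 1)) {a b : ℤ} (h : a = b) (x : F a) :
    lg b (cast (congrArg F h) x) = cast (congrArg F (congrArg (· + 1) h)) (lg a x) := by
  subst h
  rfl

/-- **Rmk. 3.10.1 (i)/(ii), abstract content, existence direction**: if every log-link map `lg m` is a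
bijection and the coric object is in bijection with (say) the copy at index `0`, then a log-link-COMPATIBLE
family of Kummer identifications `kum : ∀ m, F m ≃ C` EXISTS — constructed by transporting `F 0 ≃ C` up and
down the column along the `lg m`. (Converse of abc-iut-L6-t4's `lg_bijective_of_compatible`.)
[claim: Mochizuki2012, status: disputed] -/
theorem exists_compatible_of_bijective (hlg : ∀ m, Function.Bijective (lg m)) (e0 : F 0 ≃ C) :
    ∃ kum : ∀ m, F m ≃ C, Prop310iii_compatible F kum lg := by
  -- the log-link equivalences and their re-indexed versions `F (k - 1) ≃ F k`
  let e : ∀ m, F m ≃ F (m + 1) := fun m => Equiv.ofBijective (lg m) (hlg m)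
  let e' : ∀ k : ℤ, F (k - 1) ≃ F k := fun k =>
    (e (k - 1)).trans (Equiv.cast (congrArg F (sub_add_cancel k 1)))
  -- two-sided recursion from index `0`
  let kum : ∀ m, F m ≃ C := fun m =>
    Int.inductionOn' (motive := fun m => F m ≃ C) m 0 e0 (fun k _ ek => (e k).symm.trans ek)
      (fun k _ ek => (e' k).trans ek)
  refine ⟨kum, fun m x => ?_⟩
  rcases le_or_gt 0 m with hm | hm
  · -- upward: `kum (m+1) = (e m)⁻¹ ≫ kum m`
    have h1 : kum (m + 1) = (e m).symm.trans (kum m) :=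
      Int.inductionOn'_add_one (motive := fun m => F m ≃ C) hm
    rw [h1, Equiv.trans_apply]
    exact congrArg (kum m) ((Equiv.ofBijective (lg m) (hlg m)).symm_apply_apply x)
  · -- downward: `kum ((m+1) - 1) = e' (m+1) ≫ kum (m+1)`, transported along `m = m + 1 - 1`
    have hz : m + 1 ≤ 0 := by omega
    have h1 : kum (m + 1 - 1) = (e' (m + 1)).trans (kum (m + 1)) :=
      Int.inductionOn'_sub_one (motive := fun m => F m ≃ C) hz
    have hidx : m = m + 1 - 1 := (add_sub_cancel_right m 1).symm
    rw [← kum_cast_apply kum hidx x, h1, Equiv.trans_apply]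
    refine congrArg (kum (m + 1)) ?_
    change lg m x = cast _ ((Equiv.ofBijective (lg (m + 1 - 1)) (hlg (m + 1 - 1))) (cast _ x))
    rw [Equiv.ofBijective_apply, lg_cast_apply lg hidx x, cast_cast]
    exact (cast_eq _ _).symm

/-- **Rmk. 3.10.1 (i)/(ii), abstract content**: a log-link-compatible Kummer family exists IF AND ONLY IF
every log-link map is a bijection and the coric object is in bijection with the copy at index `0`.
[claim: Mochizuki2012, status: disputed] -/
theorem exists_compatible_iff (F : ℤ → Type u) (lg : ∀ m, F m → F (m + 1)) (C : Type u) :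
    (∃ kum : ∀ m, F m ≃ C, Prop310iii_compatible F kum lg) ↔
      (∀ m, Function.Bijective (lg m)) ∧ Nonempty (F 0 ≃ C) := by
  constructor
  · rintro ⟨kum, hk⟩
    exact ⟨lg_bijective_of_compatible hk, ⟨kum 0⟩⟩
  · rintro ⟨hlg, ⟨e0⟩⟩
    exact exists_compatible_of_bijective hlg e0

/-- **`Remark3101i_noCompatibleIso` characterised**: the typed `𝔪𝔬𝔡`-side obstruction "one cannot construct
log-link-compatible isomorphisms" holds iff SOME log-link map fails to be a bijection, OR the chosen coric
object `C` is not in bijection with `F 0`. [claim: Mochizuki2012, status: disputed] -/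
theorem Remark3101i_noCompatibleIso_iff (F : ℤ → Type u) (lg : ∀ m, F m → F (m + 1)) (C : Type u) :
    Remark3101i_noCompatibleIso (C := C) F lg ↔
      (∃ m, ¬ Function.Bijective (lg m)) ∨ IsEmpty (F 0 ≃ C) := by
  rw [Remark3101i_noCompatibleIso, exists_compatible_iff, not_and_or, not_forall, not_nonempty_iff]

/-- The INTENDED mechanism of Rmk. 3.10.1 (i) ("one-sided inclusions, as opposed to precise equalities"):
a single non-bijective log-link map already forbids any compatible family, for every coric object.
[claim: Mochizuki2012, status: disputed] -/
theorem Remark3101i_noCompatibleIso_of_not_bijective {m : ℤ} (h : ¬ Function.Bijective (lg m))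
    (C : Type u) : Remark3101i_noCompatibleIso (C := C) F lg :=
  (Remark3101i_noCompatibleIso_iff F lg C).mpr (Or.inl ⟨m, h⟩)

/-- The JUNK escape (advisory A1 of the second-pass audit of p407875): with a coric object of the wrong
cardinality — e.g. `C` empty while `F 0` is inhabited — the typed obstruction holds for EVERY family of
log-link maps, bijective or not; consumers must instantiate `C` by the genuine coric object.
[claim: Mochizuki2012, status: disputed] -/
theorem Remark3101i_noCompatibleIso_of_isEmpty [Nonempty (F 0)] [IsEmpty C] :
    Remark3101i_noCompatibleIso (C := C) F lg :=
  (Remark3101i_noCompatibleIso_iff F lg C).mpr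
    (Or.inr ⟨fun e => IsEmpty.false (e (Classical.arbitrary (F 0)))⟩)

/-- Conversely, when every log-link map IS a bijection and `C ≃ F 0`, the typed obstruction FAILS (a
compatible family exists): the `𝔪𝔬𝔡`-side clause genuinely requires a non-bijective log-link map.
[claim: Mochizuki2012, status: disputed] -/
theorem not_Remark3101i_noCompatibleIso_of_bijective (hlg : ∀ m, Function.Bijective (lg m))
    (e0 : F 0 ≃ C) : ¬ Remark3101i_noCompatibleIso (C := C) F lg :=
  fun h => h (exists_compatible_of_bijective hlg e0)

end CompatibleFamilies

section Contrast

variable {CMOD Cfrak : Type u} {FMOD Ffrak : ℤ → Type u}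

/-- **`Remark3101ii_contrast` characterised** ([IUTchIII] Rmk. 3.10.1 (ii), p. 150, as typed in v4 of the
statement file): the MOD/𝔪𝔬𝔡 contrast holds iff on the `MOD`/LGP side every log-link map is a bijection and
`FMOD 0 ≃ CMOD` is inhabited, while on the `𝔪𝔬𝔡`/lgp side some log-link map is not a bijection or
`Ffrak 0 ≃ Cfrak` is empty. [claim: Mochizuki2012, status: disputed] -/
theorem Remark3101ii_contrast_iff (lgMOD : ∀ m, FMOD m → FMOD (m + 1))
    (lgfrak : ∀ m, Ffrak m → Ffrak (m + 1)) :
    Remark3101ii_contrast CMOD Cfrak FMOD Ffrak lgMOD lgfrak ↔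
      ((∀ m, Function.Bijective (lgMOD m)) ∧ Nonempty (FMOD 0 ≃ CMOD)) ∧
        ((∃ m, ¬ Function.Bijective (lgfrak m)) ∨ IsEmpty (Ffrak 0 ≃ Cfrak)) := by
  rw [Remark3101ii_contrast, exists_compatible_iff, Remark3101i_noCompatibleIso_iff]

/-- The contrast in its intended shape: bijective log-links and a coric identification on the `MOD` side,
a non-bijective log-link on the `𝔪𝔬𝔡` side, imply `Remark3101ii_contrast` (for ANY `Cfrak`).
[claim: Mochizuki2012, status: disputed] -/
theorem Remark3101ii_contrast_of (lgMOD : ∀ m, FMOD m → FMOD (m + 1))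
    (lgfrak : ∀ m, Ffrak m → Ffrak (m + 1)) (hMOD : ∀ m, Function.Bijective (lgMOD m))
    (eMOD : FMOD 0 ≃ CMOD) {m : ℤ} (hfrak : ¬ Function.Bijective (lgfrak m)) :
    Remark3101ii_contrast CMOD Cfrak FMOD Ffrak lgMOD lgfrak :=
  (Remark3101ii_contrast_iff lgMOD lgfrak).mpr ⟨⟨hMOD, ⟨eMOD⟩⟩, Or.inl ⟨m, hfrak⟩⟩

/-- Under the contrast, the `MOD`-side log-link maps are bijections (so the `MOD` column is "rigid" in the
sense of Fig. 3.2: each copy determines the next). [claim: Mochizuki2012, status: disputed] -/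
theorem Remark3101ii_contrast.bijective_MOD {lgMOD : ∀ m, FMOD m → FMOD (m + 1)}
    {lgfrak : ∀ m, Ffrak m → Ffrak (m + 1)}
    (h : Remark3101ii_contrast CMOD Cfrak FMOD Ffrak lgMOD lgfrak) (m : ℤ) :
    Function.Bijective (lgMOD m) :=
  ((Remark3101ii_contrast_iff lgMOD lgfrak).mp h).1.1 m

/-- Under the contrast with a GENUINE coric object on the `𝔪𝔬𝔡` side (`Ffrak 0 ≃ Cfrak` inhabited), some
`𝔪𝔬𝔡`-side log-link map is not a bijection ("one-sided inclusions"). [claim: Mochizuki2012, status: disputed] -/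
theorem Remark3101ii_contrast.exists_not_bijective_frak {lgMOD : ∀ m, FMOD m → FMOD (m + 1)}
    {lgfrak : ∀ m, Ffrak m → Ffrak (m + 1)}
    (h : Remark3101ii_contrast CMOD Cfrak FMOD Ffrak lgMOD lgfrak) (efrak : Ffrak 0 ≃ Cfrak) :
    ∃ m, ¬ Function.Bijective (lgfrak m) := by
  rcases ((Remark3101ii_contrast_iff lgMOD lgfrak).mp h).2 with h' | h'
  · exact h'
  · exact (h'.false efrak).elim

end Contrast

end Literature.IUT.LogThetaLattice
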